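import Mathlib.AlgebraicGeometry.Morphisms.Proper
import Mathlib.AlgebraicGeometry.Limits
import Literature.AlgebraicGeometry.Limits.PushoutOpenImmersion
import Literature.AlgebraicGeometry.Morphisms.OpenGluing
import HarnessLib

/-!
# Gluing a scheme over one open to the base: discharge of the named fact `OpenGluing`

Topic: `Literature/AlgebraicGeometry/Morphisms`. We prove the named fact
`Literature.AlgebraicGeometry.Morphisms.OpenGluing` (The Stacks Project, Tag 01LH, two-piece
case): for opens `V, W` covering a scheme `S` and `π : Y → V` an isomorphism over `V ∩ W`, the
scheme `Y` (over `V`) and the open `W` (over `W`) glue to `ρ : N → S` with `ρ⁻¹(V) = Y`,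
`ρ` an isomorphism over `W`, and `ρ` proper when `π` is.

The glued scheme is Mathlib's pushout of schemes along the two open immersions
`π⁻¹(V ∩ W) ↪ Y` and `π⁻¹(V ∩ W) ≅ V ∩ W ↪ W` (a locally directed colimit,
`Mathlib/AlgebraicGeometry/Gluing.lean`, `Mathlib/AlgebraicGeometry/Limits.lean`); the structure
map is `pushout.desc`. The two charts of the pushout meet exactly in `π⁻¹(V ∩ W)`
(`Literature/AlgebraicGeometry/Limits/PushoutOpenImmersion`), which identifies `ρ⁻¹(V)` with the
chart `Y` and `ρ⁻¹(W)` with the chart `W`; the cartesian square is Mathlib's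
`IsOpenImmersion.isPullback`, and properness of `ρ` is checked on the cover `{V, W}`
(`IsZariskiLocalAtTarget`).

## References

* The Stacks Project, Tag 01LH (relative glueing of schemes). [StacksProject]
-/

noncomputable section

open CategoryTheory CategoryTheory.Limits AlgebraicGeometry

namespace Literature.AlgebraicGeometry.Morphisms

universe u

open Literature.AlgebraicGeometry.Limits

/-- **Two-chart gluing over a base.** Let `V, W` be opens covering `S`, `π : Y → V`, and let
`g : U' → W` be an open immersion from an open `U' ⊆ Y` over `S` (i.e. `g` followed by `W ↪ S`
is `U' ↪ Y → V ↪ S`) such that `U'` contains `π⁻¹(V ∩ W)` and `g(U')` contains `W ∩ V`. Then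
the pushout `N = Y ⨿_{U'} W` with its induced map `ρ : N → S` satisfies `ρ⁻¹(V) = Y`
(cartesian square with the open immersion `Y ↪ N`), `ρ ∣_ W` is an isomorphism, and `ρ` is
proper if `π` is. [cite: StacksProject, Tag 01LH] -/
theorem exists_glued_of_charts {S : Scheme.{u}} (V W : S.Opens) (hVW : V ⊔ W = ⊤)
    {Y : Scheme.{u}} (π : Y ⟶ (V : Scheme.{u})) (U' : Y.Opens) (g : (U' : Scheme.{u}) ⟶ W)
    [IsOpenImmersion g] (hg : U'.ι ≫ π ≫ V.ι = g ≫ W.ι)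
    (hU' : ∀ y : Y, (π y).1 ∈ W → y ∈ U') (hsurj : ∀ z : W, z.1 ∈ V → z ∈ Set.range g) :
    ∃ (N : Scheme.{u}) (ρ : N ⟶ S) (i : Y ⟶ N), IsOpenImmersion i ∧
      IsPullback i π ρ V.ι ∧ IsIso (ρ ∣_ W) ∧ (IsProper π → IsProper ρ) := by
  haveI := isOpenImmersion_inl U'.ι g
  haveI := isOpenImmersion_inr U'.ι g
  let ρ : pushout U'.ι g ⟶ S := pushout.desc (π ≫ V.ι) W.ι hg
  have hlρ : pushout.inl U'.ι g ≫ ρ = π ≫ V.ι := pushout.inl_desc _ _ _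
  have hrρ : pushout.inr U'.ι g ≫ ρ = W.ι := pushout.inr_desc _ _ _
  have hcov := range_inl_union_range_inr U'.ι g
  -- `ρ⁻¹(V)` is the chart `Y`
  have hV : ρ ⁻¹ᵁ V = (pushout.inl U'.ι g).opensRange := by
    ext x
    constructor
    · intro hx
      replace hx : ρ x ∈ V := hx
      rcases Set.eq_univ_iff_forall.mp hcov x with ⟨y, rfl⟩ | ⟨z, rfl⟩
      · exact ⟨y, rfl⟩
      · rw [← Scheme.Hom.comp_apply, hrρ] at hx
        have hz : z.1 ∈ V := hx
        obtain ⟨u, rfl⟩ := hsurj z hz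
        exact ⟨U'.ι u, by
          change (U'.ι ≫ pushout.inl U'.ι g) u = (g ≫ pushout.inr U'.ι g) u
          rw [pushout.condition]⟩
    · rintro ⟨y, rfl⟩
      change (pushout.inl U'.ι g ≫ ρ) y ∈ V
      rw [hlρ]
      exact (π y).2
  -- `ρ⁻¹(W)` is the chart `W`
  have hW : ρ ⁻¹ᵁ W = (pushout.inr U'.ι g).opensRange := by
    ext x
    constructor
    · intro hx
      replace hx : ρ x ∈ W := hx
      rcases Set.eq_univ_iff_forall.mp hcov x with ⟨y, rfl⟩ | ⟨z, rfl⟩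
      · rw [← Scheme.Hom.comp_apply, hlρ] at hx
        have hy : y ∈ U' := hU' y hx
        exact ⟨g ⟨y, hy⟩, by
          change (g ≫ pushout.inr U'.ι g) ⟨y, hy⟩ = (U'.ι ≫ pushout.inl U'.ι g) ⟨y, hy⟩
          rw [pushout.condition]⟩
      · exact ⟨z, rfl⟩
    · rintro ⟨z, rfl⟩
      change (pushout.inr U'.ι g ≫ ρ) z ∈ W
      rw [hrρ]
      exact z.2
  have hpb : IsPullback π (pushout.inl U'.ι g) V.ι ρ :=
    IsOpenImmersion.isPullback _ _ _ _ hlρ (by rw [Scheme.Opens.opensRange_ι]; exact hV)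
  have hisoW : IsIso (ρ ∣_ W) :=
    isIso_morphismRestrict_of_preimage_eq ρ _ W (pushout.inr U'.ι g).isoOpensRange.inv
      (by rw [← hrρ, Scheme.Hom.isoOpensRange_inv_comp_assoc]) hW
  refine ⟨pushout U'.ι g, ρ, pushout.inl U'.ι g, inferInstance, hpb.flip, hisoW, fun hπ => ?_⟩
  apply IsZariskiLocalAtTarget.of_iSup_eq_top (P := @IsProper) (fun b : Bool => cond b V W)
    (by rw [iSup_bool_eq]; exact hVW)
  rintro (_ | _)
  · exact MorphismProperty.of_isIso @IsProper (ρ ∣_ W)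
  · have he := (isPullback_morphismRestrict ρ V).isoIsPullback_hom_fst _ _ hpb
    change IsProper (ρ ∣_ V)
    rw [← he]
    infer_instance

/-- **Relative gluing, two pieces** (The Stacks Project, Tag 01LH with cover `{V, W}`,
`X_V = Y`, `X_W = W`): discharge of the named fact `OpenGluing`. Apply
`exists_glued_of_charts` to the chart `g = (π ∣ π⁻¹(V ∩ W)) ≫ (V ∩ W ↪ W)`, an open immersion
because `π` is an isomorphism over `V ∩ W`. [cite: StacksProject, Tag 01LH] -/
theorem OpenGluing_holds : OpenGluing.{u} := by
  intro S V W hVW Y π hπ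
  refine exists_glued_of_charts V W hVW π (π ⁻¹ᵁ (V.ι ⁻¹ᵁ W))
    ((π ∣_ (V.ι ⁻¹ᵁ W)) ≫ (V.ι ∣_ W)) (by simp [morphismRestrict_ι_assoc]) (fun y hy => hy)
    (fun z hz => ?_)
  obtain ⟨u, hu⟩ := (π ∣_ (V.ι ⁻¹ᵁ W)).surjective ⟨⟨z.1, hz⟩, z.2⟩
  refine ⟨u, ?_⟩
  rw [Scheme.Hom.comp_apply, hu]
  apply Subtype.ext
  rw [morphismRestrict_base_coe]
  rfl

end Literature.AlgebraicGeometry.Morphisms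

end
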